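import Summits.AtomisticToContinuum.FouriersLaw.Theses.PuiseuxTransferLedger
import Summits.AtomisticToContinuum.FouriersLaw.Theorems.PhononMeanFreePathBoundaryKubo
import Summits.AtomisticToContinuum.FouriersLaw.Theorems.PuiseuxTransferLedgerFiniteResponseProfileTTCF

/-!
# The kinetic-temperature response profile exists: `PuiseuxTransferLedger.FiniteResponseProfile`
(item stmt-AtomisticToContinuum-12011, shared support of the `FouriersLaw` routes)

For `P = pinnedChain ω₂ lam β γ` (all four `> 0`), under weak-NESS uniqueness, along every steady-state family `μ`,
for every `T > 0`, `N` and site `i : Fin N`, the difference quotient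
`(μ_{N,T+δ/2,T-δ/2}(p_i²) - μ_{N,T,T}(p_i²))/δ` has a limit as `δ → 0`, `δ ≠ 0`.

Proof: the `gibbs-ttcf` line of crux `PhononMeanFreePath.BoundaryKubo` (`Theorems/PhononMeanFreePathBoundaryKubo*.lean`),
run for the observable `p_i²` instead of the end kinetic temperature `p_N²` (`N + 1` sites `0..N`, `μ₀` the Gibbs
measure at `T`, `K^δ_s = transitionKernel (N+1) (T+δ/2) (T-δ/2) s`):
* the locally uniform Harris theorem (landed stubs `stub_uniformHarris_of_minorization ∘ stub_uniformMinorization_of ∘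
  (stub_uniformLocalMinorization, stub_uniformBallGeHalf, stub_jointFeller)`) gives, for `|δ| ≤ δ₀`, weak steady states
  `ν_δ` with `|K^δ_t f(z) - ν_δ(f)| ≤ C e^{θH(z)} e^{-ct}` for continuous `|f| ≤ e^{θH}`; by uniqueness the family member
  IS `ν_δ`, and at `δ = 0` the Gibbs state (`steadyFamily_apply_self`), whose `p_i²`-moment is `T` (`gibbs_sq_momentum`);
* `S → ∞` in the finite-time Gibbs TTCF identity at site `i` (`gibbsTTCF_site`, the identity of `stub_gibbsTTCF` for
  `p_i²`, file `…FiniteResponseProfileTTCF`; hypothesis `hH2` of `siteResponse_tendsto`, supplied in the closing theorem):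
  `ν_δ(p_i²) - T = δ (γ/2T²) Ψᵢ(δ)`, `Ψᵢ(δ) = ∫₀^∞ μ₀((p_0² - p_N²) K^δ_s p_i²) ds` (`steady_response_of_identity_site`,
  recentring by `μ₀(p_0²) = μ₀(p_N²)`, `corr_decay`);
* `Ψᵢ(δ) → Ψᵢ(0)` by dominated convergence in `s` (uniform bound `M e^{-cs}`) and in `z` (`tendsto_corr_delta_site`,
  kernel continuity `stub_kernelContinuity` in the bath temperatures).
Hence the limit is `θ_{N+1}(i) = (γ/2T²) Ψᵢ(0)`; `N = 0` has no sites. No definitions.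
-/

noncomputable section

open scoped NNReal ENNReal Topology
open MeasureTheory Filter Set

namespace Summit.AtomisticToContinuum.FouriersLaw.Theorems.PuiseuxTransferLedgerFiniteResponseProfile

open Literature.MathematicalPhysics.KineticTheory.HeatConduction
open Literature.MathematicalPhysics.KineticTheory Literature.Probability.Process OscillatorChain
open ProbabilityTheory
open Summit.AtomisticToContinuum.FouriersLaw.Theorems.SubdiffusiveBondHeat
open Summit.AtomisticToContinuum.FouriersLaw.Theorems.IncoherentChannel.Negative.GibbsStein (gibbs_sq_momentum)
open Summit.AtomisticToContinuum.FouriersLaw.Theorems.IncoherentChannel.Negative.KernelMoments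
  (sq_momentum_le_two_mul_hamiltonian)
open Summit.AtomisticToContinuum.FouriersLaw.Theorems.BoundaryKubo.Negative.LoadBearing
  (UniqueSteady SteadyFamily steadyFamily_apply_self)
open Summit.AtomisticToContinuum.FouriersLaw.Theorems.BoundaryKubo.GibbsTtcf

/-! ### `S → ∞` in the site-`i` TTCF identity at one pair of bath temperatures -/

section OnePair

variable {ω₂ lam β γ : ℝ} (hω : 0 < ω₂) (hl : 0 ≤ lam) (hβ : 0 ≤ β) (hγ : 0 ≤ γ) {N : ℕ}
  {a b : ℝ} {ν : Measure (PhaseSpace (N + 1))} {θ C c : ℝ} (hθ : 0 < θ) (hc : 0 < c)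
  (hH : ∀ (z : PhaseSpace (N + 1)) (t : ℝ≥0) (f : PhaseSpace (N + 1) → ℝ), Continuous f →
    (∀ y, |f y| ≤ Real.exp (θ * (pinnedChain ω₂ lam β γ).hamiltonian (N + 1) y)) →
    |(∫ y, f y ∂((pinnedChain ω₂ lam β γ).transitionKernel (N + 1) a b t z)) - ∫ y, f y ∂ν| ≤
      C * Real.exp (θ * (pinnedChain ω₂ lam β γ).hamiltonian (N + 1) z) * Real.exp (-c * t))
  {T : ℝ} (hT : 0 < T) (hθT : θ * T < 1)
include hω hl hβ hγ hθ hc hH hT hθT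

/-- **`S → ∞` in the finite-time identity at site `i`.** Given the Harris bound at `(a, b)` with limit `ν`, the
Gibbs measure `μ₀` at `T` (`θT < 1`) and an identity `μ₀(K_S p_i²) - μ₀(p_i²) = κ ∫₀^S Φ` for all `S ≥ 0` with
`Φ(s) = μ₀((p_0² - p_N²) · K_s p_i²)`: `Φ` is integrable on `(0, ∞)`, `|Φ(s)| ≤ M_Φ e^{-cs}` with `M_Φ` depending
only on `(θ, C, T)` (recentring by `μ₀(p_0²) = μ₀(p_N²) = T`, `corr_decay`), and `ν(p_i²) - T = κ ∫_{(0,∞)} Φ`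
(the left side tends to `ν(p_i²) - μ₀(p_i²)` by `corr_decay` with `g = 1`). The case `i = N` is
`steady_response_of_identity` of line `gibbs-ttcf`. [folklore] -/
theorem steady_response_of_identity_site (i : Fin (N + 1)) {κ : ℝ}
    (hid : ∀ S : ℝ, 0 ≤ S →
      (∫ z, (∫ y, (y.2 i) ^ 2
          ∂((pinnedChain ω₂ lam β γ).transitionKernel (N + 1) a b S.toNNReal z))
          ∂((pinnedChain ω₂ lam β γ).gibbsMeasure (N + 1) T)) -
        (∫ z, (z.2 i) ^ 2 ∂((pinnedChain ω₂ lam β γ).gibbsMeasure (N + 1) T)) =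
      κ * ∫ s in (0 : ℝ)..S, ∫ z, ((z.2 0) ^ 2 - (z.2 (Fin.last N)) ^ 2) *
          (∫ y, (y.2 i) ^ 2
            ∂((pinnedChain ω₂ lam β γ).transitionKernel (N + 1) a b s.toNNReal z))
          ∂((pinnedChain ω₂ lam β γ).gibbsMeasure (N + 1) T)) :
    IntegrableOn (fun s : ℝ => ∫ z, ((z.2 0) ^ 2 - (z.2 (Fin.last N)) ^ 2) *
        (∫ y, (y.2 i) ^ 2 ∂((pinnedChain ω₂ lam β γ).transitionKernel (N + 1) a b s.toNNReal z))
        ∂((pinnedChain ω₂ lam β γ).gibbsMeasure (N + 1) T)) (Ioi 0) ∧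
    (∀ s : ℝ, 0 ≤ s → |∫ z, ((z.2 0) ^ 2 - (z.2 (Fin.last N)) ^ 2) *
        (∫ y, (y.2 i) ^ 2 ∂((pinnedChain ω₂ lam β γ).transitionKernel (N + 1) a b s.toNNReal z))
        ∂((pinnedChain ω₂ lam β γ).gibbsMeasure (N + 1) T)| ≤
      2 / θ * C * (4 / ((1 / T - θ) / 2)) *
        (∫ z, Real.exp ((θ + (1 / T - θ) / 2) * (pinnedChain ω₂ lam β γ).hamiltonian (N + 1) z)
          ∂((pinnedChain ω₂ lam β γ).gibbsMeasure (N + 1) T)) * Real.exp (-c * s)) ∧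
    (∫ y, (y.2 i) ^ 2 ∂ν) - T =
      κ * ∫ s in Ioi (0 : ℝ), ∫ z, ((z.2 0) ^ 2 - (z.2 (Fin.last N)) ^ 2) *
        (∫ y, (y.2 i) ^ 2 ∂((pinnedChain ω₂ lam β γ).transitionKernel (N + 1) a b s.toNNReal z))
        ∂((pinnedChain ω₂ lam β γ).gibbsMeasure (N + 1) T) := by
  set P := pinnedChain ω₂ lam β γ with hPdef
  set μ₀ := P.gibbsMeasure (N + 1) T with hμ₀
  set ϑ := (1 / T - θ) / 2 with hϑ
  set Φ : ℝ → ℝ := fun s => ∫ z, ((z.2 0) ^ 2 - (z.2 (Fin.last N)) ^ 2) *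
    (∫ y, (y.2 i) ^ 2 ∂(P.transitionKernel (N + 1) a b s.toNNReal z)) ∂μ₀ with hΦ
  set m : ℝ := ∫ y, (y.2 i) ^ 2 ∂ν with hm
  haveI : IsProbabilityMeasure μ₀ := pinnedChain_isProbabilityMeasure_gibbsMeasure hω hl hβ γ (N + 1) hT
  have hP : P.IsConfining := pinnedChain_isConfining hω hl hβ hγ
  have hθT' : θ < 1 / T := by rwa [lt_div_iff₀ hT]
  have hϑ0 : 0 < ϑ := by rw [hϑ]; linarith
  have hθϑ : θ + ϑ < 1 / T := by rw [hϑ]; linarith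
  -- Gibbs moments
  have hpT : ∀ j : Fin (N + 1), ∫ z, z.2 j ^ 2 ∂μ₀ = T := fun j => gibbs_sq_momentum hω hl hβ hT j
  have hpi : ∀ j : Fin (N + 1), Integrable (fun z : PhaseSpace (N + 1) => z.2 j ^ 2) μ₀ := fun j =>
    integrable_of_abs_le_exp (pinnedChain_integrable_exp_mul_hamiltonian_gibbsMeasure hω hl hβ γ (N + 1) hT
      (by linarith : ϑ < 1 / T)) (by fun_prop) (fun z => abs_sq_momentum_le_exp hP hϑ0 (N + 1) z j)
  have hW0 : ∫ z, ((z.2 0) ^ 2 - (z.2 (Fin.last N)) ^ 2) ∂μ₀ = 0 := by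
    rw [integral_sub (hpi 0) (hpi _), hpT, hpT, sub_self]
  -- the weights `W = p_0² - p_N²` and `1`
  have hWc : Continuous fun z : PhaseSpace (N + 1) => (z.2 0) ^ 2 - (z.2 (Fin.last N)) ^ 2 := by fun_prop
  have hWb : ∀ z : PhaseSpace (N + 1), |(z.2 0) ^ 2 - (z.2 (Fin.last N)) ^ 2| ≤
      4 / ϑ * Real.exp (ϑ * P.hamiltonian (N + 1) z) := fun z => abs_sq_sub_sq_le_exp hP hϑ0 (N + 1) z _ _
  have h1b : ∀ z : PhaseSpace (N + 1), |(1 : ℝ)| ≤ 1 * Real.exp (ϑ * P.hamiltonian (N + 1) z) := fun z => by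
    rw [abs_one, one_mul]
    exact Real.one_le_exp (mul_nonneg hϑ0.le (hP.hamiltonian_nonneg (N + 1) z))
  -- decay of `Φ`
  have hΦb : ∀ s : ℝ, 0 ≤ s → |Φ s| ≤ 2 / θ * C * (4 / ϑ) *
      (∫ z, Real.exp ((θ + ϑ) * P.hamiltonian (N + 1) z) ∂μ₀) * Real.exp (-c * s) := by
    intro s hs
    have h := (corr_decay hω hl hβ hγ hθ hH hT hθϑ hWc hWb i s.toNNReal).2
    rwa [hW0, zero_mul, sub_zero, Real.coe_toNNReal _ hs] at h
  have hΦm : Measurable Φ := measurable_corr_time hω hl hβ hγ (N + 1) a b μ₀ hWc (by fun_prop)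
  have hΦi : IntegrableOn Φ (Ioi 0) := integrableOn_Ioi_of_abs_le_exp hc hΦm fun s hs => hΦb s hs.le
  refine ⟨hΦi, hΦb, ?_⟩
  -- the left-hand side tends to `m - T`
  have hL : Tendsto (fun S : ℝ => (∫ z, (∫ y, (y.2 i) ^ 2
      ∂(P.transitionKernel (N + 1) a b S.toNNReal z)) ∂μ₀) - ∫ z, (z.2 i) ^ 2 ∂μ₀)
      atTop (𝓝 (m - T)) := by
    refine tendsto_of_abs_sub_le_exp hc
      (M := 2 / θ * C * 1 * ∫ z, Real.exp ((θ + ϑ) * P.hamiltonian (N + 1) z) ∂μ₀) fun S hS => ?_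
    have h := (corr_decay hω hl hβ hγ hθ hH hT hθϑ continuous_const h1b i S.toNNReal).2
    simp only [one_mul, integral_const, probReal_univ, smul_eq_mul] at h
    rw [Real.coe_toNNReal _ hS] at h
    rw [hpT]
    calc _ = |(∫ z, ∫ y, y.2 i ^ 2 ∂(P.transitionKernel (N + 1) a b S.toNNReal z) ∂μ₀) - m| := by
          ring_nf
      _ ≤ _ := h
  exact eq_integral_Ioi_of_interval_identity hL hΦi hid

end OnePair

/-! ### `δ → 0` inside the Gibbs integral, site `i` -/

section Family

variable {ω₂ lam β γ : ℝ} (hω : 0 < ω₂) (hl : 0 ≤ lam) (hβ : 0 ≤ β) (hγ : 0 ≤ γ) {N : ℕ} {T : ℝ}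
  (hT : 0 < T) {δ₀ θ C c : ℝ} (hδ₀ : 0 < δ₀) (hθ : 0 < θ) {ν : ℝ → Measure (PhaseSpace (N + 1))}
  (hH : ∀ δ : ℝ, |δ| ≤ δ₀ → ∀ (z : PhaseSpace (N + 1)) (t : ℝ≥0) (f : PhaseSpace (N + 1) → ℝ),
    Continuous f → (∀ y, |f y| ≤ Real.exp (θ * (pinnedChain ω₂ lam β γ).hamiltonian (N + 1) y)) →
    |(∫ y, f y ∂((pinnedChain ω₂ lam β γ).transitionKernel (N + 1) (T + δ / 2) (T - δ / 2) t z)) -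
        ∫ y, f y ∂(ν δ)| ≤
      C * Real.exp (θ * (pinnedChain ω₂ lam β γ).hamiltonian (N + 1) z) * Real.exp (-c * t))
  (i : Fin (N + 1))
  (hK : ∀ (s : ℝ≥0) (z : PhaseSpace (N + 1)), Tendsto (fun δ : ℝ => ∫ y, (y.2 i) ^ 2
      ∂((pinnedChain ω₂ lam β γ).transitionKernel (N + 1) (T + δ / 2) (T - δ / 2) s z)) (𝓝 0)
    (𝓝 (∫ y, (y.2 i) ^ 2 ∂((pinnedChain ω₂ lam β γ).transitionKernel (N + 1) T T s z))))
include hω hl hβ hγ hT hδ₀ hθ hH hK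

/-- **`δ → 0` inside the Gibbs integral, site `i`.** Under a Harris bound uniform in `|δ| ≤ δ₀` for the kernels
`K^δ_s = transitionKernel (N+1) (T+δ/2) (T-δ/2) s` and pointwise continuity of `δ ↦ K^δ_s p_i²(z)` at `0`, for every
continuous weight `|g| ≤ C_g e^{ϑH}` with `θ + ϑ < 1/T`: `∫ g · K^δ_s p_i² dμ₀ → ∫ g · K_s p_i² dμ₀` (`δ → 0`) —
dominated convergence with the dominating function `|g| (B + (2C/θ) e^{-cs} e^{θH})` from `|ν_δ(p_i²)| ≤ B`
(`abs_steady_sq_momentum_le`) and `harris_sq_momentum`. The case `i = N` is `tendsto_corr_delta`. [folklore] -/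
theorem tendsto_corr_delta_site {ϑ Cg : ℝ} (hθϑ : θ + ϑ < 1 / T) {g : PhaseSpace (N + 1) → ℝ}
    (hg : Continuous g) (hgb : ∀ z, |g z| ≤ Cg * Real.exp (ϑ * (pinnedChain ω₂ lam β γ).hamiltonian (N + 1) z))
    (s : ℝ≥0) :
    Tendsto (fun δ : ℝ => ∫ z, g z * ∫ y, (y.2 i) ^ 2
        ∂((pinnedChain ω₂ lam β γ).transitionKernel (N + 1) (T + δ / 2) (T - δ / 2) s z)
        ∂((pinnedChain ω₂ lam β γ).gibbsMeasure (N + 1) T)) (𝓝 0)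
      (𝓝 (∫ z, g z * ∫ y, (y.2 i) ^ 2 ∂((pinnedChain ω₂ lam β γ).transitionKernel (N + 1) T T s z)
        ∂((pinnedChain ω₂ lam β γ).gibbsMeasure (N + 1) T))) := by
  set P := pinnedChain ω₂ lam β γ with hPdef
  set μ₀ := P.gibbsMeasure (N + 1) T with hμ₀
  set C₁ := 2 / θ * C with hC₁
  set B := C₁ * Real.exp (θ * P.hamiltonian (N + 1) 0) with hB
  set C₂ := C₁ * Real.exp (-c * s) with hC₂
  have hϑT : ϑ < 1 / T := by linarith
  have hHc : Continuous (P.hamiltonian (N + 1)) := pinnedChain_continuous_hamiltonian ω₂ lam β γ (N + 1)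
  have hexp : Integrable (fun z => Real.exp ((θ + ϑ) * P.hamiltonian (N + 1) z)) μ₀ :=
    pinnedChain_integrable_exp_mul_hamiltonian_gibbsMeasure hω hl hβ γ (N + 1) hT hθϑ
  have hexpϑ : Integrable (fun z => Real.exp (ϑ * P.hamiltonian (N + 1) z)) μ₀ :=
    pinnedChain_integrable_exp_mul_hamiltonian_gibbsMeasure hω hl hβ γ (N + 1) hT hϑT
  -- the dominating function
  set bound : PhaseSpace (N + 1) → ℝ := fun z =>
    |g z| * (B + C₂ * Real.exp (θ * P.hamiltonian (N + 1) z)) with hbound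
  have hBC : 0 ≤ B ∧ 0 ≤ C₂ := by
    have h := abs_steady_sq_momentum_le hω hl hβ hγ hθ (hH 0 (by rw [abs_zero]; exact hδ₀.le)) i
    have hB0 : 0 ≤ B := (abs_nonneg _).trans h
    have hC₁0 : 0 ≤ C₁ := nonneg_of_mul_nonneg_left hB0 (Real.exp_pos _)
    exact ⟨hB0, mul_nonneg hC₁0 (Real.exp_pos _).le⟩
  have hbd0 : ∀ z, 0 ≤ B + C₂ * Real.exp (θ * P.hamiltonian (N + 1) z) := fun z =>
    add_nonneg hBC.1 (mul_nonneg hBC.2 (Real.exp_pos _).le)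
  have hbint : Integrable bound μ₀ := by
    refine ((hexpϑ.const_mul (Cg * B)).add (hexp.const_mul (Cg * C₂))).mono'
      ((continuous_abs.comp hg).mul (continuous_const.add (continuous_const.mul
        (Real.continuous_exp.comp (continuous_const.mul hHc))))).aestronglyMeasurable
      (Eventually.of_forall fun z => ?_)
    rw [Real.norm_of_nonneg (mul_nonneg (abs_nonneg _) (hbd0 z))]
    calc |g z| * (B + C₂ * Real.exp (θ * P.hamiltonian (N + 1) z))
        ≤ (Cg * Real.exp (ϑ * P.hamiltonian (N + 1) z)) * (B + C₂ * Real.exp (θ * P.hamiltonian (N + 1) z)) :=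
          mul_le_mul_of_nonneg_right (hgb z) (hbd0 z)
      _ = Cg * B * Real.exp (ϑ * P.hamiltonian (N + 1) z) +
          Cg * C₂ * (Real.exp (θ * P.hamiltonian (N + 1) z) * Real.exp (ϑ * P.hamiltonian (N + 1) z)) := by
          ring
      _ = Cg * B * Real.exp (ϑ * P.hamiltonian (N + 1) z) +
          Cg * C₂ * Real.exp ((θ + ϑ) * P.hamiltonian (N + 1) z) := by rw [← Real.exp_add]; ring_nf
  have hev : ∀ᶠ δ in 𝓝 (0 : ℝ), |δ| ≤ δ₀ := by
    filter_upwards [eventually_abs_sub_lt 0 hδ₀] with δ hδ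
    rw [sub_zero] at hδ
    exact hδ.le
  refine tendsto_integral_filter_of_dominated_convergence bound ?_ ?_ hbint ?_
  · refine Eventually.of_forall fun δ => hg.aestronglyMeasurable.mul ?_
    exact ((by fun_prop : Continuous fun y : PhaseSpace (N + 1) => y.2 i ^ 2).stronglyMeasurable
      |>.integral_kernel (κ := P.transitionKernel (N + 1) (T + δ / 2) (T - δ / 2) s)).aestronglyMeasurable
  · filter_upwards [hev] with δ hδ
    refine Eventually.of_forall fun z => ?_
    have hm := abs_steady_sq_momentum_le hω hl hβ hγ hθ (hH δ hδ) i
    have hd := harris_sq_momentum hω hl hβ hγ hθ (hH δ hδ) i z s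
    rw [norm_mul, Real.norm_eq_abs, Real.norm_eq_abs]
    refine mul_le_mul_of_nonneg_left ?_ (abs_nonneg _)
    have htri : ∀ x y : ℝ, |x| ≤ |y| + |x - y| := fun x y => by
      linarith [abs_sub_abs_le_abs_sub x y]
    calc |∫ y, y.2 i ^ 2 ∂(P.transitionKernel (N + 1) (T + δ / 2) (T - δ / 2) s z)|
        ≤ |∫ y, y.2 i ^ 2 ∂(ν δ)| +
          |(∫ y, y.2 i ^ 2 ∂(P.transitionKernel (N + 1) (T + δ / 2) (T - δ / 2) s z)) -
            ∫ y, y.2 i ^ 2 ∂(ν δ)| := htri _ _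
      _ ≤ B + C₂ * Real.exp (θ * P.hamiltonian (N + 1) z) := by
          refine add_le_add hm ?_
          calc _ ≤ C₁ * Real.exp (θ * P.hamiltonian (N + 1) z) * Real.exp (-c * s) := hd
            _ = C₂ * Real.exp (θ * P.hamiltonian (N + 1) z) := by ring
  · exact Eventually.of_forall fun z => (hK s z).const_mul (g z)

end Family

/-! ### The response of the kinetic temperature at site `i` -/

/-- **The linear response of the kinetic temperature at site `i`** of the pinned anharmonic chain with `N + 1`
sites (all four parameters `> 0`), under weak-NESS uniqueness and along every steady family `μ`, GIVEN the
finite-time Gibbs TTCF identity at site `i` (hypothesis `hH2`, supplied by `gibbsTTCF_site`):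
`(μ_{(N+1),T+δ/2,T-δ/2}(p_i²) - T)/δ → (γ/2T²) ∫_{(0,∞)} μ₀((p_0² - p_N²) · K_s p_i²) ds` as `δ → 0`, `δ ≠ 0`
(`μ₀` the Gibbs measure at `T`, `K_s` the equal-temperature kernels). Locally uniform Harris
(`stub_uniformHarris_of_minorization ∘ stub_uniformMinorization_of ∘ …`, landed) identifies the family member at
`0 < |δ| ≤ δ₀` with the Harris steady state (uniqueness); `S → ∞` by `steady_response_of_identity_site`; `δ → 0`
inside the time integral by dominated convergence (`tendsto_corr_delta_site`, kernel continuity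
`stub_kernelContinuity`). The case `i = N` (with the value rewritten by the sum rule) is `stub_limitExchange`.
[folklore] -/
theorem siteResponse_tendsto {ω₂ lam β γ : ℝ} (hω : 0 < ω₂) (hl : 0 < lam) (hβ : 0 < β) (hγ : 0 < γ)
    (hU : UniqueSteady ω₂ lam β γ) {μ : (M : ℕ) → ℝ → ℝ → Measure (PhaseSpace M)}
    (hμ : SteadyFamily ω₂ lam β γ μ) {T : ℝ} (hT : 0 < T) (N : ℕ) (i : Fin (N + 1))
    (hH2 : ∀ δ : ℝ, |δ| < 2 * T → ∀ S : ℝ, 0 ≤ S →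
        (∫ z, (∫ y, (y.2 i) ^ 2
            ∂((pinnedChain ω₂ lam β γ).transitionKernel (N + 1) (T + δ / 2) (T - δ / 2) S.toNNReal z))
            ∂((pinnedChain ω₂ lam β γ).gibbsMeasure (N + 1) T)) -
          (∫ z, (z.2 i) ^ 2 ∂((pinnedChain ω₂ lam β γ).gibbsMeasure (N + 1) T)) =
        δ * (γ / (2 * T ^ 2)) *
          ∫ s in (0 : ℝ)..S, ∫ z, ((z.2 0) ^ 2 - (z.2 (Fin.last N)) ^ 2) *
            (∫ y, (y.2 i) ^ 2
              ∂((pinnedChain ω₂ lam β γ).transitionKernel (N + 1) (T + δ / 2) (T - δ / 2) s.toNNReal z))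
            ∂((pinnedChain ω₂ lam β γ).gibbsMeasure (N + 1) T)) :
    Tendsto (fun δ : ℝ => ((∫ z, (z.2 i) ^ 2 ∂(μ (N + 1) (T + δ / 2) (T - δ / 2))) - T) / δ) (𝓝[≠] 0)
      (𝓝 (γ / (2 * T ^ 2) * ∫ s in Ioi (0 : ℝ), ∫ z, ((z.2 0) ^ 2 - (z.2 (Fin.last N)) ^ 2) *
          (∫ y, (y.2 i) ^ 2 ∂((pinnedChain ω₂ lam β γ).transitionKernel (N + 1) T T s.toNNReal z))
          ∂((pinnedChain ω₂ lam β γ).gibbsMeasure (N + 1) T))) := by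
  -- Harris data, locally uniform in the bath temperatures (landed stubs of line `gibbs-ttcf`)
  have hH1 := stub_uniformHarris_of_minorization
    (stub_uniformMinorization_of stub_uniformLocalMinorization stub_uniformBallGeHalf stub_jointFeller)
  obtain ⟨δ₀, θ, C, c, hδ₀, hδ₀T, hθ, hθT, -, hc, hfam⟩ := hH1 ω₂ lam β γ hω hl hβ hγ N T hT
  have hfam' : ∀ δ : ℝ, ∃ ν : Measure (PhaseSpace (N + 1)), |δ| ≤ δ₀ →
      (pinnedChain ω₂ lam β γ).IsSteadyState (N + 1) (T + δ / 2) (T - δ / 2) ν ∧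
      ∀ (z : PhaseSpace (N + 1)) (t : ℝ≥0) (f : PhaseSpace (N + 1) → ℝ), Continuous f →
        (∀ y, |f y| ≤ Real.exp (θ * (pinnedChain ω₂ lam β γ).hamiltonian (N + 1) y)) →
        |(∫ y, f y ∂((pinnedChain ω₂ lam β γ).transitionKernel (N + 1) (T + δ / 2) (T - δ / 2) t z)) -
            ∫ y, f y ∂ν| ≤
          C * Real.exp (θ * (pinnedChain ω₂ lam β γ).hamiltonian (N + 1) z) * Real.exp (-c * t) := by
    intro δ
    by_cases hδ : |δ| ≤ δ₀
    · obtain ⟨ν, hst, -, hH⟩ := hfam δ hδ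
      exact ⟨ν, fun _ => ⟨hst, hH⟩⟩
    · exact ⟨0, fun h => absurd h hδ⟩
  choose ν hν using hfam'
  have hHf := fun δ (hδ : |δ| ≤ δ₀) => (hν δ hδ).2
  -- identification of the steady states (uniqueness)
  have hab : ∀ δ : ℝ, |δ| ≤ δ₀ → 0 < T + δ / 2 ∧ 0 < T - δ / 2 := fun δ hδ => by
    have h := abs_le.1 hδ
    constructor <;> linarith
  have hμν : ∀ δ : ℝ, |δ| ≤ δ₀ → μ (N + 1) (T + δ / 2) (T - δ / 2) = ν δ := fun δ hδ =>
    hU (N + 1) _ _ (hab δ hδ).1 (hab δ hδ).2 _ _ (hμ (N + 1) _ _ (hab δ hδ).1 (hab δ hδ).2) (hν δ hδ).1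
  -- kernel continuity for `p_i²` along the temperature protocol
  have hK : ∀ (s : ℝ≥0) (z : PhaseSpace (N + 1)), Tendsto (fun δ : ℝ => ∫ y, (y.2 i) ^ 2
      ∂((pinnedChain ω₂ lam β γ).transitionKernel (N + 1) (T + δ / 2) (T - δ / 2) s z)) (𝓝 0)
      (𝓝 (∫ y, (y.2 i) ^ 2 ∂((pinnedChain ω₂ lam β γ).transitionKernel (N + 1) T T s z))) := by
    intro s z
    have hpoly : ∃ (C' : ℝ) (k : ℕ), ∀ y : PhaseSpace (N + 1),
        |y.2 i ^ 2| ≤ C' * (1 + (pinnedChain ω₂ lam β γ).hamiltonian (N + 1) y) ^ k := by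
      refine ⟨2, 1, fun y => ?_⟩
      rw [abs_of_nonneg (sq_nonneg _), pow_one]
      have h1 := sq_momentum_le_two_mul_hamiltonian hω hl.le hβ.le γ y i
      linarith
    exact tendsto_temperatures hT (stub_kernelContinuity ω₂ lam β γ hω hl hβ hγ N s z _ (by fun_prop) hpoly)
  -- the integrands `Φ δ`, `Φ₀` and the uniform bound
  set Φ : ℝ → ℝ → ℝ := fun δ s => ∫ z, ((z.2 0) ^ 2 - (z.2 (Fin.last N)) ^ 2) *
      (∫ y, (y.2 i) ^ 2
        ∂((pinnedChain ω₂ lam β γ).transitionKernel (N + 1) (T + δ / 2) (T - δ / 2) s.toNNReal z))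
      ∂((pinnedChain ω₂ lam β γ).gibbsMeasure (N + 1) T) with hΦ
  set Φ₀ : ℝ → ℝ := fun s => ∫ z, ((z.2 0) ^ 2 - (z.2 (Fin.last N)) ^ 2) *
      (∫ y, (y.2 i) ^ 2 ∂((pinnedChain ω₂ lam β γ).transitionKernel (N + 1) T T s.toNNReal z))
      ∂((pinnedChain ω₂ lam β γ).gibbsMeasure (N + 1) T) with hΦ₀
  set ϑ := (1 / T - θ) / 2 with hϑ
  set MΦ := 2 / θ * C * (4 / ϑ) *
      (∫ z, Real.exp ((θ + ϑ) * (pinnedChain ω₂ lam β γ).hamiltonian (N + 1) z)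
        ∂((pinnedChain ω₂ lam β γ).gibbsMeasure (N + 1) T)) with hMΦ
  have hθT' : θ < 1 / T := by rwa [lt_div_iff₀ hT]
  have hϑ0 : 0 < ϑ := by rw [hϑ]; linarith
  have hθϑ : θ + ϑ < 1 / T := by rw [hϑ]; linarith
  haveI : IsProbabilityMeasure ((pinnedChain ω₂ lam β γ).gibbsMeasure (N + 1) T) :=
    pinnedChain_isProbabilityMeasure_gibbsMeasure hω hl.le hβ.le γ (N + 1) hT
  -- Step C: `S → ∞` in the TTCF identity, for every `|δ| ≤ δ₀`
  have hC := fun δ (hδ : |δ| ≤ δ₀) => steady_response_of_identity_site hω hl.le hβ.le hγ.le hθ hc (hHf δ hδ)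
    hT hθT i (hH2 δ (lt_of_le_of_lt hδ hδ₀T))
  -- Step D: `δ → 0` inside the time integral
  have hev : ∀ᶠ δ in 𝓝 (0 : ℝ), |δ| ≤ δ₀ := by
    filter_upwards [eventually_abs_sub_lt 0 hδ₀] with δ hδ
    rw [sub_zero] at hδ
    exact hδ.le
  have hΨ : Tendsto (fun δ => ∫ s in Ioi (0 : ℝ), Φ δ s) (𝓝 0) (𝓝 (∫ s in Ioi (0 : ℝ), Φ₀ s)) := by
    refine tendsto_integral_filter_of_dominated_convergence (fun s => MΦ * Real.exp (-c * s)) ?_ ?_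
      ((exp_neg_integrableOn_Ioi 0 hc).const_mul MΦ) ?_
    · exact Eventually.of_forall fun δ => (measurable_corr_time hω hl.le hβ.le hγ.le (N + 1) _ _ _
        (by fun_prop) (by fun_prop)).aestronglyMeasurable
    · filter_upwards [hev] with δ hδ
      exact (ae_restrict_iff' measurableSet_Ioi).2 (Eventually.of_forall fun s hs => by
        rw [Real.norm_eq_abs]; exact (hC δ hδ).2.1 s (le_of_lt hs))
    · refine (ae_restrict_iff' measurableSet_Ioi).2 (Eventually.of_forall fun s _ => ?_)
      exact tendsto_corr_delta_site hω hl.le hβ.le hγ.le hT hδ₀ hθ hHf i hK hθϑ (by fun_prop)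
        (fun z => abs_sq_sub_sq_le_exp (pinnedChain_isConfining hω hl.le hβ.le hγ.le) hϑ0 (N + 1) z 0
          (Fin.last N)) s.toNNReal
  -- Step E: assembly along `𝓝[≠] 0`
  have hlim : Tendsto (fun δ : ℝ => γ / (2 * T ^ 2) * ∫ s in Ioi (0 : ℝ), Φ δ s) (𝓝[≠] 0)
      (𝓝 (γ / (2 * T ^ 2) * ∫ s in Ioi (0 : ℝ), Φ₀ s)) :=
    (hΨ.const_mul _).mono_left nhdsWithin_le_nhds
  refine hlim.congr' ?_
  have hev' : ∀ᶠ δ in 𝓝[≠] (0 : ℝ), |δ| ≤ δ₀ ∧ δ ≠ 0 :=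
    (eventually_nhdsWithin_of_eventually_nhds hev).and self_mem_nhdsWithin
  filter_upwards [hev'] with δ ⟨hδ, hne⟩
  rw [hμν δ hδ, (hC δ hδ).2.2, mul_assoc, mul_div_cancel_left₀ _ hne]


/-! ### The item -/

/-- **`PuiseuxTransferLedger.FiniteResponseProfile`** (item stmt-AtomisticToContinuum-12011): under weak-NESS uniqueness,
along every steady-state family of the pinned anharmonic chain, for every `T > 0`, `N` and site `i`, the difference
quotient `(μ_{N,T+δ/2,T-δ/2}(p_i²) - μ_{N,T,T}(p_i²))/δ` converges as `δ → 0`, `δ ≠ 0` (to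
`(γ/2T²) ∫₀^∞ μ₀((p_0² - p_{N-1}²) K_s p_i²) ds`). `N = 0`: no sites; `N = M + 1`: `siteResponse_tendsto` with the TTCF
identity `gibbsTTCF_site`, after `μ_{N,T,T} = μ₀` (uniqueness, `steadyFamily_apply_self`) and `μ₀(p_i²) = T`
(`gibbs_sq_momentum`). [folklore] -/
theorem finiteResponseProfile_proof :
    Summit.AtomisticToContinuum.FouriersLaw.Theses.PuiseuxTransferLedger.FiniteResponseProfile := by
  intro ω₂ lam β γ hω hl hβ hγ hU μ hμ T hT N i
  cases N with
  | zero => exact i.elim0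
  | succ M =>
    have h := siteResponse_tendsto hω hl hβ hγ hU hμ hT M i
      (fun δ hδ S hS => gibbsTTCF_site hω hl hβ hγ M i hT hδ hS)
    have hTT : ∫ x, (x.2 i) ^ 2 ∂(μ (M + 1) T T) = T := by
      rw [steadyFamily_apply_self hω hl hβ hU hμ hT (M + 1)]
      exact gibbs_sq_momentum hω hl.le hβ.le hT i
    exact ⟨_, h.congr' (Eventually.of_forall fun δ => by rw [hTT])⟩

end Summit.AtomisticToContinuum.FouriersLaw.Theorems.PuiseuxTransferLedgerFiniteResponseProfile

end
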